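import Summits.ResolutionOfSingularities.ResolutionOfSingularities.Theorems.MarkedTransferCampaignW46MohWindowSurface
import Literature.AlgebraicGeometry.Resolution.CompletionPrimeOrderGenerization
import Literature.RingTheory.MvPowerSeries.MaximalIdealPow
import HarnessLib

/-!
# [OURS · L1 W4.6 rung (iii-2)] SCOPE WITNESS: an ISOLATED surface window that is NOT FORMALLY PURELY INSEPARABLE
# `g = X₂^p + X₀^d + X₁^d + X₀^a·X₁^b·X₂` in `κ⟦X₀, X₁, X₂⟧`
# (`p < d < 2p`, `a, b ≥ 2`, `a + b = d`; e.g. `z³ + x⁴ + y⁴ + x²y²z`)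

Cell `res-hironaka`, LADDER-RESOLUTION rung L (D-0089), slot W4.6 rung (iii-2); seat res-D-pv-050 AS res-L1-s46-pv-12 (gen 6).
Host route MarkedTransfer, `--kind proof --supports stmt-ResolutionOfSingularities-16155 --as helper`; no definition (the
witness is carried as a hypothesis `hg : g = …`).

WHY. o1's typed rung `MohWindowSurfaceInsepPermissiblyTerminates p K` reads the window «`z^p + f`, `f ∈ (x, y)^d`» with an
IDEAL power (DESIGN POINT (PUR)); the MODEL whose termination res-L1-s46-pv-6 proved and whose scheme transport is being assembled
(pv-6 g4 `Regime.mohWindowSurfacePoly`; this seat's exit door p514487 / formal coordinates p516134) is the PURELY INSEPARABLE ansatz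
`x^p + F(y_j, y_i)`. This file shows IN THE KERNEL that the two differ even at ISOLATED singular points: `g` is a window (C) with
`p`-fold locus the closed point (D), yet no formal coordinate change and no unit bring `(g)` to the form `(X₂^p + F(X₀, X₁))` (B),
because every derivation preserving `(g)` is singular (A) while a purely inseparable presentation transports `∂/∂X₂` to a
non-singular one. (res-D-pv-008 names the family in H2-CENSUS item 8 and a HEAVY variant `z^p + y^d + x^{2d} + z x^a y^b`, NOT
treated here; `g` itself is TAME — a SCOPE witness, not a termination obstruction.) READING: the (iii-2) regime as typed is
STRICTLY LARGER than the Moh / Hauser–Wagner purely-inseparable class; pv-6's `Poly` sibling / a «formally purely inseparable»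
clause (pv-008 (R1)) is the honest home of the model transport.

WHAT (kernel, axioms standard): `derivation_apply_witness(_ring)` (Leibniz expansion) · `constantCoeff_derivation_X_eq_zero` (A) ·
`derivation_apply_mem_maximalIdeal` · `ringEquiv_apply_ne` (B) · `mohWindowSurfaceAt_span` (C) · `not_map_span_le_maximalIdeal_sq` (D).

HONEST FRAMING. Nothing here is a statement of H. Hironaka's manuscript [Hironaka2017] (Th. 16.6 p.84, Th. 16.13 p.87 — scope only,
under adjudication); the regime is an OURS campaign definition (o1). AI-written; AI review is weaker than expert review. No `sorry`.
-/

noncomputable section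

set_option linter.dupNamespace false -- mandated namespace of this single-conjunct summit

open MvPowerSeries IsLocalRing
open Literature.AlgebraicGeometry.Resolution

namespace Summit.ResolutionOfSingularities.ResolutionOfSingularities.Theorems

namespace CampaignW46

namespace SeparableWindowWitness

universe u

variable {κ : Type u} [Field κ]






/-- Bookkeeping: the coefficient of `monomial n c * φ` at `n` is `c · φ(0)`. [folklore] -/
theorem coeff_monomial_mul_self (n : Fin 3 →₀ ℕ) (c : κ) (φ : (MvPowerSeries (Fin 3) κ)) :
    coeff n (monomial n c * φ) = c * constantCoeff φ := by
  rw [coeff_monomial_mul, if_pos le_rfl, tsub_self, coeff_zero_eq_constantCoeff_apply]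

/-- Bookkeeping: `monomial n c * φ` has no coefficient at `m` unless `n ≤ m`. [folklore] -/
theorem coeff_monomial_mul_of_not_le {n m : Fin 3 →₀ ℕ} (h : ¬ n ≤ m) (c : κ) (φ : (MvPowerSeries (Fin 3) κ)) :
    coeff m (monomial n c * φ) = 0 := by
  rw [coeff_monomial_mul, if_neg h]

/-- Bookkeeping: `φ * monomial n c` has no coefficient at `m` unless `n ≤ m`. [folklore] -/
theorem coeff_mul_monomial_of_not_le {n m : Fin 3 →₀ ℕ} (h : ¬ n ≤ m) (c : κ) (φ : (MvPowerSeries (Fin 3) κ)) :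
    coeff m (φ * monomial n c) = 0 := by
  rw [coeff_mul_monomial, if_neg h]

/-- [OURS · L1 W4.6 rung (iii-2)] NOT a statement of the manuscript. **Leibniz expansion of `δ g`** for
`g = X₂^p + X₀^d + X₁^d + X₀^a X₁^b X₂` and ANY derivation `δ` of `κ⟦X₀,X₁,X₂⟧` (the `X₂^p` term dies in
characteristic `p`): `δ g = (d X₀^{d−1} + a X₀^{a−1} X₁^b X₂)·δX₀ + (d X₁^{d−1} + b X₀^a X₁^{b−1} X₂)·δX₁ + X₀^a X₁^b·δX₂`.
[folklore] -/
theorem derivation_apply_witness_ring {p : ℕ} [Fact p.Prime] [CharP κ p] {d a b : ℕ}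
    {g : (MvPowerSeries (Fin 3) κ)} (hg : g = X 2 ^ p + X 0 ^ d + X 1 ^ d + X 0 ^ a * X 1 ^ b * X 2)
    (δ : Derivation ℤ (MvPowerSeries (Fin 3) κ) (MvPowerSeries (Fin 3) κ)) :
    δ g = (d : MvPowerSeries (Fin 3) κ) * X 0 ^ (d - 1) * δ (X 0) + (a : MvPowerSeries (Fin 3) κ) * X 0 ^ (a - 1) * X 1 ^ b * X 2 * δ (X 0) +
      (d : MvPowerSeries (Fin 3) κ) * X 1 ^ (d - 1) * δ (X 1) + (b : MvPowerSeries (Fin 3) κ) * X 0 ^ a * X 1 ^ (b - 1) * X 2 * δ (X 1) +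
      X 0 ^ a * X 1 ^ b * δ (X 2) := by
  haveI : CharP (MvPowerSeries (Fin 3) κ) p := charP_of_injective_ringHom (MvPowerSeries.C_injective (σ := Fin 3) (R := κ)) p
  have hp : ((p : ℕ) : (MvPowerSeries (Fin 3) κ)) = 0 := CharP.cast_eq_zero (MvPowerSeries (Fin 3) κ) p
  rw [hg]
  simp only [map_add, Derivation.leibniz, Derivation.leibniz_pow, smul_eq_mul, nsmul_eq_mul, hp, zero_mul,
    zero_add]
  ring

/-- The same expansion, every term written `monomial n c * δ(X_i)` (for coefficient extraction). [folklore] -/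
theorem derivation_apply_witness {p : ℕ} [Fact p.Prime] [CharP κ p] {d a b : ℕ}
    {g : (MvPowerSeries (Fin 3) κ)} (hg : g = X 2 ^ p + X 0 ^ d + X 1 ^ d + X 0 ^ a * X 1 ^ b * X 2)
    (δ : Derivation ℤ (MvPowerSeries (Fin 3) κ) (MvPowerSeries (Fin 3) κ)) :
    δ g = monomial (Finsupp.single 0 (d - 1)) (d : κ) * δ (X 0) +
      monomial (Finsupp.single 0 (a - 1) + Finsupp.single 1 b + Finsupp.single 2 1) (a : κ) * δ (X 0) +
      monomial (Finsupp.single 1 (d - 1)) (d : κ) * δ (X 1) +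
      monomial (Finsupp.single 0 a + Finsupp.single 1 (b - 1) + Finsupp.single 2 1) (b : κ) * δ (X 1) +
      monomial (Finsupp.single 0 a + Finsupp.single 1 b) 1 * δ (X 2) := by
  have h1 := derivation_apply_witness_ring hg δ
  have hC : ∀ n : ℕ, ((n : ℕ) : (MvPowerSeries (Fin 3) κ)) = monomial 0 (n : κ) := fun n => by rw [monomial_zero_eq_C_apply, map_natCast]
  rw [h1, X_pow_eq (0 : Fin 3) (d - 1), X_pow_eq (0 : Fin 3) (a - 1), X_pow_eq (0 : Fin 3) a, X_pow_eq (1 : Fin 3) b,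
    X_pow_eq (1 : Fin 3) (d - 1), X_pow_eq (1 : Fin 3) (b - 1), X_def (2 : Fin 3), hC d, hC a, hC b]
  simp only [monomial_mul_monomial, mul_one, zero_add]

/-- Bookkeeping on exponents: `n ≰ m` as soon as `m i < n i` for one letter. [folklore] -/
theorem not_le_of_apply_lt {n m : Fin 3 →₀ ℕ} (i : Fin 3) (h : m i < n i) : ¬ n ≤ m :=
  fun hle => absurd h (not_lt.mpr (hle i))

/-- The witness as a sum of four monomials. [folklore] -/
theorem witness_eq_monomial {p d a b : ℕ} {g : (MvPowerSeries (Fin 3) κ)}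
    (hg : g = X 2 ^ p + X 0 ^ d + X 1 ^ d + X 0 ^ a * X 1 ^ b * X 2) :
    g = monomial (Finsupp.single 2 p) 1 + monomial (Finsupp.single 0 d) 1 + monomial (Finsupp.single 1 d) 1 +
      monomial (Finsupp.single 0 a + Finsupp.single 1 b + Finsupp.single 2 1) 1 := by
  rw [hg, X_pow_eq (2 : Fin 3) p, X_pow_eq (0 : Fin 3) d, X_pow_eq (1 : Fin 3) d, X_pow_eq (0 : Fin 3) a,
    X_pow_eq (1 : Fin 3) b, X_def (2 : Fin 3), monomial_mul_monomial, monomial_mul_monomial, mul_one, mul_one]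

/-- [OURS · L1 W4.6 rung (iii-2)] NOT a statement of the manuscript. **(A) Every derivation preserving the ideal
`(g)` is SINGULAR**: if `δ g ∈ (g)` for a derivation `δ` of `κ⟦X₀,X₁,X₂⟧`, then `δX₀, δX₁, δX₂` have zero constant term —
three coefficient comparisons in `δ g = h·g`: at `X₀^{d−1}` (`d·δX₀(0) = 0`), at `X₁^{d−1}` (`d·δX₁(0) = 0`), at
`X₀^a X₁^b` (`δX₂(0) = 0`); `p ∤ d` (automatic in the window `p < d < 2p`) is read as `(d : κ) ≠ 0`; `a, b ≥ 2`. [folklore] -/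
theorem constantCoeff_derivation_X_eq_zero {p : ℕ} [Fact p.Prime] [CharP κ p] {d a b : ℕ}
    (hd : (d : κ) ≠ 0) (ha : 2 ≤ a) (hb : 2 ≤ b) (hab : a + b = d) {g : (MvPowerSeries (Fin 3) κ)}
    (hg : g = X 2 ^ p + X 0 ^ d + X 1 ^ d + X 0 ^ a * X 1 ^ b * X 2)
    (δ : Derivation ℤ (MvPowerSeries (Fin 3) κ) (MvPowerSeries (Fin 3) κ)) (hδ : δ g ∈ Ideal.span {g}) (i : Fin 3) :
    constantCoeff (δ (X i)) = 0 := by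
  have hp1 : 1 ≤ p := (Fact.out : p.Prime).one_lt.le
  obtain ⟨h, hh⟩ := Ideal.mem_span_singleton'.mp hδ
  rw [derivation_apply_witness hg δ] at hh
  rw [witness_eq_monomial hg, mul_add, mul_add, mul_add] at hh
  have hA : constantCoeff (δ (X 0)) = 0 := by
    have := congrArg (coeff (Finsupp.single (0 : Fin 3) (d - 1))) hh
    rw [map_add, map_add, map_add, map_add, map_add, map_add, map_add,
      coeff_monomial_mul_self,
      coeff_monomial_mul_of_not_le (not_le_of_apply_lt 2 (by simp)),
      coeff_monomial_mul_of_not_le (not_le_of_apply_lt 1 (by simp; omega)),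
      coeff_monomial_mul_of_not_le (not_le_of_apply_lt 2 (by simp)),
      coeff_monomial_mul_of_not_le (not_le_of_apply_lt 1 (by simp; omega)),
      coeff_mul_monomial_of_not_le (not_le_of_apply_lt 2 (by simp; omega)),
      coeff_mul_monomial_of_not_le (not_le_of_apply_lt 0 (by simp; omega)),
      coeff_mul_monomial_of_not_le (not_le_of_apply_lt 1 (by simp; omega)),
      coeff_mul_monomial_of_not_le (not_le_of_apply_lt 2 (by simp))] at this
    simpa [hd] using this
  have hB : constantCoeff (δ (X 1)) = 0 := by
    have := congrArg (coeff (Finsupp.single (1 : Fin 3) (d - 1))) hh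
    rw [map_add, map_add, map_add, map_add, map_add, map_add, map_add,
      coeff_monomial_mul_of_not_le (not_le_of_apply_lt 0 (by simp; omega)),
      coeff_monomial_mul_of_not_le (not_le_of_apply_lt 2 (by simp)),
      coeff_monomial_mul_self,
      coeff_monomial_mul_of_not_le (not_le_of_apply_lt 2 (by simp)),
      coeff_monomial_mul_of_not_le (not_le_of_apply_lt 0 (by simp; omega)),
      coeff_mul_monomial_of_not_le (not_le_of_apply_lt 2 (by simp; omega)),
      coeff_mul_monomial_of_not_le (not_le_of_apply_lt 0 (by simp; omega)),
      coeff_mul_monomial_of_not_le (not_le_of_apply_lt 1 (by simp; omega)),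
      coeff_mul_monomial_of_not_le (not_le_of_apply_lt 2 (by simp))] at this
    simpa [hd] using this
  have hC : constantCoeff (δ (X 2)) = 0 := by
    have := congrArg (coeff (Finsupp.single (0 : Fin 3) a + Finsupp.single 1 b)) hh
    rw [map_add, map_add, map_add, map_add, map_add, map_add, map_add,
      coeff_monomial_mul_of_not_le (not_le_of_apply_lt 0 (by simp; omega)),
      coeff_monomial_mul_of_not_le (not_le_of_apply_lt 2 (by simp)),
      coeff_monomial_mul_of_not_le (not_le_of_apply_lt 1 (by simp; omega)),
      coeff_monomial_mul_of_not_le (not_le_of_apply_lt 2 (by simp)),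
      coeff_monomial_mul_self,
      coeff_mul_monomial_of_not_le (not_le_of_apply_lt 2 (by simp; omega)),
      coeff_mul_monomial_of_not_le (not_le_of_apply_lt 0 (by simp; omega)),
      coeff_mul_monomial_of_not_le (not_le_of_apply_lt 1 (by simp; omega)),
      coeff_mul_monomial_of_not_le (not_le_of_apply_lt 2 (by simp))] at this
    simpa using this.symm
  fin_cases i
  exacts [hA, hB, hC]

open Literature.RingTheory.MvPowerSeries.Jets in
/-- A derivation of `κ⟦X₀,X₁,X₂⟧` with `δX_i ∈ 𝔪` for the three letters maps `𝔪` into `𝔪`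
(`𝔪 = (X₀, X₁, X₂)`, Leibniz). [folklore] -/
theorem derivation_apply_mem_maximalIdeal (δ : Derivation ℤ (MvPowerSeries (Fin 3) κ) (MvPowerSeries (Fin 3) κ)) (hδ : ∀ i, constantCoeff (δ (X i)) = 0)
    {s : (MvPowerSeries (Fin 3) κ)} (hs : s ∈ maximalIdeal (MvPowerSeries (Fin 3) κ)) : δ s ∈ maximalIdeal (MvPowerSeries (Fin 3) κ) := by
  rw [maximalIdeal_mvPowerSeries_eq_span κ (Fin 3),
    Ideal.mem_span_range_iff_exists_fun] at hs
  obtain ⟨c, rfl⟩ := hs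
  rw [map_sum]
  refine Ideal.sum_mem _ fun i _ => ?_
  rw [Derivation.leibniz, smul_eq_mul, smul_eq_mul]
  refine Ideal.add_mem _ (Ideal.mul_mem_left _ _ ?_) (Ideal.mul_mem_right _ _ ?_)
  · rw [mem_maximalIdeal_iff_constantCoeff_eq_zero]
    exact hδ i
  · exact X_mem_maximalIdeal κ (Fin 3) i

open Literature.RingTheory.MvPowerSeries.Jets in
/-- [OURS · L1 W4.6 rung (iii-2)] NOT a statement of the manuscript. **(B) `g` HAS NO PURELY INSEPARABLE
PRESENTATION IN ANY FORMAL COORDINATES**: for every ring isomorphism `e : κ⟦X₀,X₁,X₂⟧ ≅ κ'⟦X₀,X₁,X₂⟧`, every unit `u`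
and every `F` with `∂F/∂X₂ = 0` (in particular every `F ∈ κ'⟦X₀,X₁⟧`), `e(u·g) ≠ X₂^p + F`. Proof: `∂/∂X₂`
transported along `e` is a derivation `δ` of `κ⟦X⟧` killing `u·g`, hence preserving `(g)`, hence singular by (A);
but `δ(e⁻¹X₂) = 1` while `e⁻¹X₂ ∈ 𝔪`. (Contrast: `z^p + x^d(1+z) + y^d = z^p + (x(1+z)^{1/d})^d + y^d` IS purely
inseparable after a coordinate change — the obstruction is not the mere presence of `z` in `f`.) [folklore] -/
theorem ringEquiv_apply_ne {p : ℕ} [Fact p.Prime] [CharP κ p] {d a b : ℕ}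
    (hd : (d : κ) ≠ 0) (ha : 2 ≤ a) (hb : 2 ≤ b) (hab : a + b = d) {g : (MvPowerSeries (Fin 3) κ)}
    (hg : g = X 2 ^ p + X 0 ^ d + X 1 ^ d + X 0 ^ a * X 1 ^ b * X 2)
    {κ' : Type u} [Field κ'] (e : (MvPowerSeries (Fin 3) κ) ≃+* MvPowerSeries (Fin 3) κ') {u : (MvPowerSeries (Fin 3) κ)} (hu : IsUnit u)
    (F : MvPowerSeries (Fin 3) κ') (hF : MvPowerSeries.pderiv 2 F = 0) :
    e (u * g) ≠ X 2 ^ p + F := by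
  haveI : CharP (MvPowerSeries (Fin 3) κ) p := charP_of_injective_ringHom (MvPowerSeries.C_injective (σ := Fin 3) (R := κ)) p
  intro heq
  let D : Derivation κ' (MvPowerSeries (Fin 3) κ') (MvPowerSeries (Fin 3) κ') := MvPowerSeries.pderiv 2
  let ψ : (MvPowerSeries (Fin 3) κ) →+ (MvPowerSeries (Fin 3) κ) :=
    { toFun := fun s => e.symm (D (e s))
      map_zero' := by simp
      map_add' := fun x y => by simp [map_add] }
  let δ : Derivation ℤ (MvPowerSeries (Fin 3) κ) (MvPowerSeries (Fin 3) κ) :=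
    { ψ.toIntLinearMap with
      map_one_eq_zero' := by
        change e.symm (D (e 1)) = 0
        rw [map_one, Derivation.map_one_eq_zero, map_zero]
      leibniz' := fun x y => by
        change e.symm (D (e (x * y))) = x • e.symm (D (e y)) + y • e.symm (D (e x))
        rw [map_mul, Derivation.leibniz, smul_eq_mul, smul_eq_mul, smul_eq_mul, smul_eq_mul, map_add,
          map_mul, map_mul, RingEquiv.symm_apply_apply, RingEquiv.symm_apply_apply] }
  have hδ_apply : ∀ s, δ s = e.symm (D (e s)) := fun s => rfl
  have h1 : δ (u * g) = 0 := by
    rw [hδ_apply, heq, map_add, Derivation.leibniz_pow, hF, add_zero]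
    rw [show (p • ((X 2 : MvPowerSeries (Fin 3) κ') ^ (p - 1) • D (X 2))) =
      ((p : ℕ) : MvPowerSeries (Fin 3) κ') * ((X 2) ^ (p - 1) * D (X 2)) by
        rw [nsmul_eq_mul, smul_eq_mul]]
    rw [map_mul, map_natCast, CharP.cast_eq_zero, zero_mul]
  have h2 : δ g ∈ Ideal.span {g} := by
    obtain ⟨v, hv⟩ := hu.exists_left_inv
    rw [Derivation.leibniz, smul_eq_mul, smul_eq_mul] at h1
    have h3 : δ g = -(v * δ u) * g := by
      have h4 : v * (u * δ g + g * δ u) = 0 := by rw [h1, mul_zero]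
      have h5 : v * (u * δ g + g * δ u) = (v * u) * δ g + v * δ u * g := by ring
      rw [h5, hv, one_mul] at h4
      linear_combination h4
    rw [h3]
    exact Ideal.mul_mem_left _ _ (Ideal.mem_span_singleton_self g)
  have h6 := constantCoeff_derivation_X_eq_zero hd ha hb hab hg δ h2
  have h7 : e.symm (X 2) ∈ maximalIdeal (MvPowerSeries (Fin 3) κ) := by
    rw [mem_maximalIdeal_iff_constantCoeff_eq_zero]
    have hX : ¬ IsUnit (X 2 : MvPowerSeries (Fin 3) κ') := by
      rw [MvPowerSeries.isUnit_iff_constantCoeff, MvPowerSeries.constantCoeff_X]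
      exact not_isUnit_zero
    have hX' : ¬ IsUnit (e.symm (X 2)) := fun h => hX (by simpa using h.map e)
    rwa [MvPowerSeries.isUnit_iff_constantCoeff, isUnit_iff_ne_zero, not_not] at hX'
  have h8 := derivation_apply_mem_maximalIdeal δ h6 h7
  rw [hδ_apply, RingEquiv.apply_symm_apply, mem_maximalIdeal_iff_constantCoeff_eq_zero] at h8
  have h9 : D (X 2) = 1 := by
    change MvPowerSeries.pderiv 2 (X 2 : MvPowerSeries (Fin 3) κ') = 1
    rw [MvPowerSeries.pderiv_X, if_pos rfl]
  rw [h9, map_one, MvPowerSeries.constantCoeff_one] at h8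
  exact one_ne_zero h8

open Literature.RingTheory.MvPowerSeries.Jets in
/-- [OURS · L1 W4.6 rung (iii-2)] NOT a statement of the manuscript. **(C) `(g)` IS A SURFACE WINDOW** in o1ʼs
sense (`MohWindowSurfaceAt p κ⟦X⟧ (g)`, DESIGN POINT (PUR) = ideal power): r.s.p. `(X₀, X₁, X₂)`,
`f = X₀^d + X₁^d + X₀^a X₁^b X₂ ∈ (X₀, X₁)^d`, `f ∉ 𝔪^{d+1}` (coefficient of `X₀^d`), `p < d < 2p`. [folklore] -/
theorem mohWindowSurfaceAt_span {p d a b : ℕ} (hpd : p < d) (hd2 : d < 2 * p) (hab : a + b = d)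
    {g : (MvPowerSeries (Fin 3) κ)} (hg : g = X 2 ^ p + X 0 ^ d + X 1 ^ d + X 0 ^ a * X 1 ^ b * X 2) :
    MohWindowSurfaceAt p (MvPowerSeries (Fin 3) κ) (Ideal.span {g}) := by
  have hd0 : d ≠ 0 := by omega
  haveI := isRegularLocalRing_mvPowerSeries κ (Fin 3)
  have hrange : Set.range (X : Fin 3 → (MvPowerSeries (Fin 3) κ)) = {X 0, X 1, X 2} := by
    ext s
    simp only [Set.mem_range, Set.mem_insert_iff, Set.mem_singleton_iff]
    exact ⟨by rintro ⟨i, rfl⟩; fin_cases i <;> simp, by rintro (rfl | rfl | rfl); exacts [⟨0, rfl⟩, ⟨1, rfl⟩, ⟨2, rfl⟩]⟩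
  refine ⟨inferInstance, ?_, X 0, X 1, X 2, ?_, d, X 0 ^ d + X 1 ^ d + X 0 ^ a * X 1 ^ b * X 2, hpd, hd2,
    ?_, ?_, ?_⟩
  · rw [spanFinrank_maximalIdeal_mvPowerSeries κ, Nat.card_eq_fintype_card, Fintype.card_fin]
  · rw [maximalIdeal_mvPowerSeries_eq_span κ (Fin 3), hrange]
  · refine Ideal.add_mem _ (Ideal.add_mem _ ?_ ?_) ?_
    · exact Ideal.pow_mem_pow (Ideal.subset_span (by simp)) d
    · exact Ideal.pow_mem_pow (Ideal.subset_span (by simp)) d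
    · refine Ideal.mul_mem_right _ _ ?_
      rw [← hab, pow_add]
      exact Ideal.mul_mem_mul (Ideal.pow_mem_pow (Ideal.subset_span (by simp)) a)
        (Ideal.pow_mem_pow (Ideal.subset_span (by simp)) b)
  · intro hmem
    have h0 := coeff_eq_zero_of_mem_maximalIdeal_pow hmem (e := Finsupp.single 0 d)
      (by rw [Finsupp.degree_single]; exact Nat.lt_succ_self d)
    rw [X_pow_eq (0 : Fin 3) d, X_pow_eq (1 : Fin 3) d, X_pow_eq (0 : Fin 3) a, X_pow_eq (1 : Fin 3) b,
      X_def (2 : Fin 3), monomial_mul_monomial, monomial_mul_monomial, mul_one, mul_one, map_add, map_add,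
      coeff_monomial_same, coeff_monomial_ne, coeff_monomial_ne, add_zero, add_zero] at h0
    · exact one_ne_zero h0
    · exact fun h => by simpa using DFunLike.congr_fun h 2
    · exact fun h => hd0 (by simpa using DFunLike.congr_fun h 0)
  · rw [hg, add_assoc, add_assoc, add_assoc]

/-- [OURS · L1 W4.6 rung (iii-2)] NOT a statement of the manuscript. **(D) THE `p`-FOLD LOCUS OF `(g)` IS THE CLOSED
POINT** (formal form of `Regime.isolatedSing` for this germ, in the shape of the tree's `not_map_le_pow_of_isolated`):
for every prime `𝔮 ≠ 𝔪` of `κ⟦X⟧`, `(g)·κ⟦X⟧_𝔮 ⊄ (𝔮 κ⟦X⟧_𝔮)^2` — a fortiori `⊄ (𝔮)^p`. Proof: `g ∈ 𝔮^{(2)}` would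
put `∂g/∂X_i ∈ 𝔮` (tree `Derivation.apply_mem_of_mul_mem_sq`), and `(X₀^d, X₁^d, X₂^p) ⊆ (g, X₀∂₀g, X₁∂₁g, ∂₂g)`
forces `𝔮 ⊇ (X₀, X₁, X₂) = 𝔪`; needs `p ∤ d`. [cite: StacksProject, Tag 07PF] -/
theorem not_map_span_le_maximalIdeal_sq {p : ℕ} [Fact p.Prime] [CharP κ p] {d a b : ℕ}
    (hd : (d : κ) ≠ 0) (hd1 : 1 ≤ d) (ha1 : 1 ≤ a) (hb1 : 1 ≤ b) {g : (MvPowerSeries (Fin 3) κ)}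
    (hg : g = X 2 ^ p + X 0 ^ d + X 1 ^ d + X 0 ^ a * X 1 ^ b * X 2)
    (𝔮 : Ideal (MvPowerSeries (Fin 3) κ)) [𝔮.IsPrime] (h𝔮 : 𝔮 ≠ maximalIdeal (MvPowerSeries (Fin 3) κ)) :
    ¬ (Ideal.span {g}).map (algebraMap (MvPowerSeries (Fin 3) κ) (Localization.AtPrime 𝔮)) ≤
      maximalIdeal (Localization.AtPrime 𝔮) ^ 2 := by
  haveI : CharP (MvPowerSeries (Fin 3) κ) p := charP_of_injective_ringHom (MvPowerSeries.C_injective (σ := Fin 3) (R := κ)) p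
  intro hle
  have hg2 : algebraMap (MvPowerSeries (Fin 3) κ) (Localization.AtPrime 𝔮) g ∈
      (𝔮 ^ 2).map (algebraMap (MvPowerSeries (Fin 3) κ) (Localization.AtPrime 𝔮)) := by
    rw [Ideal.map_pow, Localization.AtPrime.map_eq_maximalIdeal]
    exact hle (Ideal.mem_map_of_mem _ (Ideal.mem_span_singleton_self g))
  obtain ⟨w, hw, hwg⟩ := (IsLocalization.algebraMap_mem_map_algebraMap_iff 𝔮.primeCompl
    (Localization.AtPrime 𝔮) (𝔮 ^ 2) g).mp hg2
  have hw' : w ∉ 𝔮 := hw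
  have hgq : g ∈ 𝔮 :=
    (Ideal.IsPrime.mem_or_mem ‹_› (Ideal.pow_le_self two_ne_zero hwg)).resolve_left hw'
  have hD : ∀ i : Fin 3, MvPowerSeries.pderiv i g ∈ 𝔮 := fun i =>
    Derivation.apply_mem_of_mul_mem_sq (MvPowerSeries.pderiv i) hgq hw' hwg
  have hE : ∀ i : Fin 3, MvPowerSeries.pderiv i g =
      (d : MvPowerSeries (Fin 3) κ) * X 0 ^ (d - 1) * MvPowerSeries.pderiv i (X 0) +
      (a : MvPowerSeries (Fin 3) κ) * X 0 ^ (a - 1) * X 1 ^ b * X 2 * MvPowerSeries.pderiv i (X 0) +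
      (d : MvPowerSeries (Fin 3) κ) * X 1 ^ (d - 1) * MvPowerSeries.pderiv i (X 1) +
      (b : MvPowerSeries (Fin 3) κ) * X 0 ^ a * X 1 ^ (b - 1) * X 2 * MvPowerSeries.pderiv i (X 1) +
      X 0 ^ a * X 1 ^ b * MvPowerSeries.pderiv i (X 2) := fun i =>
    derivation_apply_witness_ring hg ((MvPowerSeries.pderiv i).restrictScalars ℤ)
  have hdu : IsUnit ((d : ℕ) : (MvPowerSeries (Fin 3) κ)) := by
    rw [show ((d : ℕ) : (MvPowerSeries (Fin 3) κ)) = MvPowerSeries.C (d : κ) by rw [map_natCast]]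
    exact (isUnit_iff_ne_zero.mpr hd).map _
  obtain ⟨v, hv⟩ := hdu.exists_left_inv
  obtain ⟨d', rfl⟩ : ∃ d', d = d' + 1 := ⟨d - 1, by omega⟩
  obtain ⟨a', rfl⟩ : ∃ a', a = a' + 1 := ⟨a - 1, by omega⟩
  obtain ⟨b', rfl⟩ : ∃ b', b = b' + 1 := ⟨b - 1, by omega⟩
  simp only [Nat.add_sub_cancel] at hE
  have hmix : (X 0 : (MvPowerSeries (Fin 3) κ)) ^ (a' + 1) * X 1 ^ (b' + 1) ∈ 𝔮 := by
    have h1 := hD 2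
    rw [hE 2, MvPowerSeries.pderiv_X, MvPowerSeries.pderiv_X, MvPowerSeries.pderiv_X,
      if_neg (show ¬ ((0 : Fin 3) = 2) by decide), if_neg (show ¬ ((1 : Fin 3) = 2) by decide), if_pos rfl] at h1
    simp only [mul_zero, add_zero, zero_add, mul_one] at h1
    exact h1
  have hX0 : (X 0 : (MvPowerSeries (Fin 3) κ)) ∈ 𝔮 := by
    have h1 : X 0 * MvPowerSeries.pderiv 0 g ∈ 𝔮 := Ideal.mul_mem_left _ _ (hD 0)
    rw [hE 0, MvPowerSeries.pderiv_X, MvPowerSeries.pderiv_X, MvPowerSeries.pderiv_X, if_pos rfl,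
      if_neg (show ¬ ((1 : Fin 3) = 0) by decide), if_neg (show ¬ ((2 : Fin 3) = 0) by decide)] at h1
    simp only [mul_zero, add_zero, mul_one] at h1
    have h2 : (X 0 : (MvPowerSeries (Fin 3) κ)) *
          (((d' + 1 : ℕ) : (MvPowerSeries (Fin 3) κ)) * X 0 ^ d' + ((a' + 1 : ℕ) : (MvPowerSeries (Fin 3) κ)) * X 0 ^ a' * X 1 ^ (b' + 1) * X 2) =
        ((d' + 1 : ℕ) : (MvPowerSeries (Fin 3) κ)) * X 0 ^ (d' + 1) +
          ((a' + 1 : ℕ) : (MvPowerSeries (Fin 3) κ)) * X 2 * (X 0 ^ (a' + 1) * X 1 ^ (b' + 1)) := by ring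
    rw [h2] at h1
    have h3 : ((d' + 1 : ℕ) : (MvPowerSeries (Fin 3) κ)) * X 0 ^ (d' + 1) ∈ 𝔮 :=
      (Ideal.add_mem_iff_left 𝔮 (Ideal.mul_mem_left _ _ hmix)).mp h1
    have h4 : (X 0 : (MvPowerSeries (Fin 3) κ)) ^ (d' + 1) ∈ 𝔮 := by
      have := Ideal.mul_mem_left 𝔮 v h3
      rwa [← mul_assoc, hv, one_mul] at this
    exact Ideal.IsPrime.mem_of_pow_mem ‹_› _ h4
  have hX1 : (X 1 : (MvPowerSeries (Fin 3) κ)) ∈ 𝔮 := by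
    have h1 : X 1 * MvPowerSeries.pderiv 1 g ∈ 𝔮 := Ideal.mul_mem_left _ _ (hD 1)
    rw [hE 1, MvPowerSeries.pderiv_X, MvPowerSeries.pderiv_X, MvPowerSeries.pderiv_X,
      if_neg (show ¬ ((0 : Fin 3) = 1) by decide), if_pos rfl, if_neg (show ¬ ((2 : Fin 3) = 1) by decide)] at h1
    simp only [mul_zero, add_zero, zero_add, mul_one] at h1
    have h2 : (X 1 : (MvPowerSeries (Fin 3) κ)) *
          (((d' + 1 : ℕ) : (MvPowerSeries (Fin 3) κ)) * X 1 ^ d' + ((b' + 1 : ℕ) : (MvPowerSeries (Fin 3) κ)) * X 0 ^ (a' + 1) * X 1 ^ b' * X 2) =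
        ((d' + 1 : ℕ) : (MvPowerSeries (Fin 3) κ)) * X 1 ^ (d' + 1) +
          ((b' + 1 : ℕ) : (MvPowerSeries (Fin 3) κ)) * X 2 * (X 0 ^ (a' + 1) * X 1 ^ (b' + 1)) := by ring
    rw [h2] at h1
    have h3 : ((d' + 1 : ℕ) : (MvPowerSeries (Fin 3) κ)) * X 1 ^ (d' + 1) ∈ 𝔮 :=
      (Ideal.add_mem_iff_left 𝔮 (Ideal.mul_mem_left _ _ hmix)).mp h1
    have h4 : (X 1 : (MvPowerSeries (Fin 3) κ)) ^ (d' + 1) ∈ 𝔮 := by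
      have := Ideal.mul_mem_left 𝔮 v h3
      rwa [← mul_assoc, hv, one_mul] at this
    exact Ideal.IsPrime.mem_of_pow_mem ‹_› _ h4
  have hX2 : (X 2 : (MvPowerSeries (Fin 3) κ)) ∈ 𝔮 := by
    have h1 : (X 2 : (MvPowerSeries (Fin 3) κ)) ^ p = g - (X 0 ^ (d' + 1) + X 1 ^ (d' + 1) + X 0 ^ (a' + 1) * X 1 ^ (b' + 1) * X 2) := by
      rw [hg]; ring
    have h2 : (X 2 : (MvPowerSeries (Fin 3) κ)) ^ p ∈ 𝔮 := by
      rw [h1]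
      refine Ideal.sub_mem _ hgq (Ideal.add_mem _ (Ideal.add_mem _ ?_ ?_) (Ideal.mul_mem_right _ _ hmix))
      · exact Ideal.pow_mem_of_mem 𝔮 hX0 _ (Nat.succ_pos d')
      · exact Ideal.pow_mem_of_mem 𝔮 hX1 _ (Nat.succ_pos d')
    exact Ideal.IsPrime.mem_of_pow_mem ‹_› _ h2
  apply h𝔮
  refine ((maximalIdeal.isMaximal (MvPowerSeries (Fin 3) κ)).eq_of_le (Ideal.IsPrime.ne_top ‹_›) ?_).symm
  rw [maximalIdeal_mvPowerSeries_eq_span κ (Fin 3), Ideal.span_le]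
  rintro _ ⟨i, rfl⟩
  fin_cases i
  exacts [hX0, hX1, hX2]


end SeparableWindowWitness

end CampaignW46

end Summit.ResolutionOfSingularities.ResolutionOfSingularities.Theorems

end
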